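import Summits.Ventures.QEC.CircuitDistance.ETowerGeo
import HarnessLib

/-!
# P3-PORT STEP 2 (E-fold tower): FIBRE COMPLETENESS of `fiberK` (CARD-7 §5 S1; PORT-SPEC S1)
# (cell `qec`, experiment CDX, seat qec-cdx-type-1; twin of `Census.FoldPiv.mem_fiber_of_solution` + `Census.FoldFiber2.fiber_complete`)

For a `k`-block fold step with index facts `OKK G nb`, an arbitrary big column function `col` (the level's EXTENDED column
table) and fibre / partner column tables `M j = col (emb j) ⊕ col (partner (emb j))`, `Mp j = col (partner (emb j))` on the
small window: if `fiberK G (nsK G nb) M Mp W (support of t)` succeeds, every big word `u` of weight `≤ W` with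
`⊕_{J ∈ u} col J = 0` and fold `t` is (the mask of) one of its outputs.  The linear-algebra core (`gaussPiv`, `pivOK`,
`scan`, `solutions`: `Census.FoldPiv`, `FoldScanPT*`) is geometry-free and imported; the only differences to the Census
twin are the explicit window size and the pruning threshold (`fiberK` prunes by reductions from budget `s ≥ 1`).
Only completeness (fibre ⊆ outputs) is needed downstream, as in Census.  Generic; no data; no `native_decide`.
-/

namespace Summit.Ventures.QEC.CircuitDistance.ETower

open Summit.Ventures.QEC.Census Summit.Ventures.QEC.Census.Fold

/-! ## What success of `fiberK` certifies -/

/-- If `fiberK` succeeds, the core pivot structure verified. -/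
theorem pivOKcore_of_fiberK (G : Geo) (ns : ℕ) (M Mp : ℕ → ℕ) (W : ℕ) (P : List ℕ) {out : List (List ℕ)}
    (hout : fiberK G ns M Mp W P = some out) : pivOKcore (P.map M) (gaussPiv (P.map M)) = true := by
  unfold fiberK at hout
  simp only at hout
  split at hout
  · split at hout
    · exact pivOKcore_of_pivOK (by assumption)
    · simp at hout
  · split at hout
    · assumption
    · simp at hout

/-- If `fiberK` succeeds with pruning active (`s ≥ 1`), the full pivot structure verified. -/
theorem pivOK_of_fiberK (G : Geo) (ns : ℕ) (M Mp : ℕ → ℕ) (W : ℕ) (P : List ℕ) {out : List (List ℕ)}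
    (hout : fiberK G ns M Mp W P = some out) (hs : 1 ≤ (W - P.length) / 2) :
    pivOK (P.map M) (gaussPiv (P.map M)) = true := by
  unfold fiberK at hout
  simp only at hout
  rw [if_pos hs] at hout
  split at hout
  · assumption
  · simp at hout

/-- **Combinatorial completeness of `fiberK`**: every within-budget sub-list of the outside positions (whose residual reduces
to `0` when pruning is active) with a listed solution yields a recorded word. -/
theorem mem_fiberK_of_solution (G : Geo) (ns : ℕ) (M Mp : ℕ → ℕ) (W : ℕ) (P : List ℕ) {out : List (List ℕ)}
    (hout : fiberK G ns M Mp W P = some out) (e' : List ℕ)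
    (he' : e'.Sublist (outsideOf ns P))
    (hlen : e'.length ≤ (W - P.length) / 2)
    (hred : 1 ≤ (W - P.length) / 2 → (gaussPiv (P.map M)).red (frhs Mp P ^^^ xorIdx M e') = 0) (x : ℕ)
    (hx : x ∈ (gaussPiv (P.map M)).solutions (P.map M) (frhs Mp P ^^^ xorIdx M e')) :
    mkWord G P e'.reverse x ∈ out := by
  unfold fiberK at hout
  simp only at hout
  set Pv := gaussPiv (P.map M)
  by_cases hs : 1 ≤ (W - P.length) / 2
  · rw [if_pos hs] at hout
    split at hout
    · simp only [Option.some.injEq] at hout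
      subst hout
      rw [List.mem_map]
      refine ⟨(e'.reverse ++ [], x), ?_, by simp⟩
      have hsub : (e'.map fun o => (o, M o, Pv.red (M o))).Sublist
          ((outsideOf ns P).map fun o => (o, M o, Pv.red (M o))) := he'.map _
      have hx2 : x ∈ Pv.solutions (P.map M)
          (frhs Mp P ^^^ xorIdx (fun oc : ℕ × ℕ × ℕ => oc.2.1) (e'.map fun o => (o, M o, Pv.red (M o)))) := by
        rw [xorIdx_map]; exact hx
      have hrv : Pv.red (frhs Mp P) ^^^ xorIdx (fun oc : ℕ × ℕ × ℕ => oc.2.2)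
          (e'.map fun o => (o, M o, Pv.red (M o))) = 0 := by
        rw [xorIdx_map, ← hred hs, red_xor, red_xorIdx]; rfl
      have := scan_complete _ _ _ ((W - P.length) / 2) (frhs Mp P) _ [] _ hsub
        (by rw [List.length_map]; exact hlen) hrv x hx2
      rw [List.map_map] at this
      have hid : List.map (Prod.fst ∘ fun o => (o, M o, Pv.red (M o))) e' = e' := by
        rw [show (Prod.fst ∘ fun o => (o, M o, Pv.red (M o))) = id from rfl, List.map_id]
      rw [hid] at this
      exact this
    · simp at hout
  · rw [if_neg hs] at hout
    split at hout
    · simp only [Option.some.injEq] at hout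
      subst hout
      rw [List.mem_map]
      refine ⟨(e'.reverse ++ [], x), ?_, by simp⟩
      have hsub : (e'.map fun o => (o, M o, 0)).Sublist
          ((outsideOf ns P).map fun o => (o, M o, 0)) := he'.map _
      have hx2 : x ∈ Pv.solutions (P.map M)
          (frhs Mp P ^^^ xorIdx (fun oc : ℕ × ℕ × ℕ => oc.2.1) (e'.map fun o => (o, M o, 0))) := by
        rw [xorIdx_map]; exact hx
      have hrv : 0 ^^^ xorIdx (fun oc : ℕ × ℕ × ℕ => oc.2.2) (e'.map fun o => (o, M o, (0 : ℕ))) = 0 := by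
        rw [xorIdx_map, show ((fun oc : ℕ × ℕ × ℕ => oc.2.2) ∘ fun o => (o, M o, (0 : ℕ))) = fun _ => 0 from rfl,
          xorIdx_const_zero, Nat.xor_zero]
      have := scan_complete _ _ _ ((W - P.length) / 2) (frhs Mp P) _ [] _ hsub
        (by rw [List.length_map]; exact hlen) hrv x hx2
      rw [List.map_map] at this
      have hid : List.map (Prod.fst ∘ fun o => (o, M o, (0 : ℕ))) e' = e' := by
        rw [show (Prod.fst ∘ fun o => (o, M o, (0 : ℕ))) = id from rfl, List.map_id]
      rw [hid] at this
      exact this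
    · simp at hout

/-! ## Fibre completeness -/

section Complete

variable {G : Geo} {nb : ℕ}

/-- **FIBRE COMPLETENESS of `fiberK`.**  Under the index facts `OKK G nb`: if the enumerator (with fibre / partner column
tables of the big column function `col` on the small window) succeeds on the support of `t`, every big word of weight `≤ W`
with zero `col`-syndrome whose fold is `t` is (the mask of) one of its outputs. -/
theorem fiberK_complete (hG : OKK G nb) {col : ℕ → ℕ} {M Mp : ℕ → ℕ}
    (hM : ∀ j, j < nsK G nb → M j = col (G.emb j) ^^^ col (G.partner (G.emb j)))
    (hMp : ∀ j, j < nsK G nb → Mp j = col (G.partner (G.emb j))) {W t : ℕ} (ht : t < 2 ^ nsK G nb)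
    {out : List (List ℕ)} (hout : fiberK G (nsK G nb) M Mp W (bitsOf (nsK G nb) 0 t) = some out) {u : ℕ}
    (hu : u < 2 ^ nK G nb) (hker : kerK col (nK G nb) u) (hwt : popc (nK G nb) u ≤ W) (hfold : foldWK G nb u = t) :
    ∃ S ∈ out, maskOf S = u ∧ (∀ J ∈ S, J < nK G nb) ∧ S.length = popc (nK G nb) u := by
  -- names
  set fc : ℕ → ℕ := fun j => col (G.emb j) ^^^ col (G.partner (G.emb j)) with hfcdef
  set P := bitsOf (nsK G nb) 0 t with hPdef
  set a := aPartK G nb u with ha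
  set b := bPartK G nb u with hb
  have hab : a ^^^ b = t := by rw [ha, hb, ← foldWK_eq_parts, hfold]
  have hbt : b = a ^^^ t := by rw [← hab, ← Nat.xor_assoc, Nat.xor_self, Nat.zero_xor]
  have hPlt : ∀ j ∈ P, j < nsK G nb := fun j hj => lt_of_mem_bitsOf hj
  have hPmask : maskOf P = t := maskOf_bitsOf_zero _ _ ht
  have hPlen : P.length = popc (nsK G nb) t := length_bitsOf _ _ _
  have hPM : P.map M = P.map fc := List.map_congr_left fun j hj => hM j (hPlt j hj)
  set O := outsideOf (nsK G nb) P with hOdef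
  set e := O.filter fun j => (a &&& b).testBit j with hedef
  set x := restrictTo P 0 a with hxdef
  have hPnodup : P.Nodup := hPdef ▸ nodup_bitsOf _ _ _
  have hOmem : ∀ j, j ∈ O ↔ j < nsK G nb ∧ j ∉ P := fun j => by
    rw [hOdef, outsideOf, mem_bitsOf_zero_iff, Nat.testBit_xor, Nat.testBit_two_pow_sub_one,
      testBit_maskOf_nodup P hPnodup]
    by_cases hj : j < nsK G nb <;> by_cases hp : j ∈ P <;> simp [hj, hp]
  have hOlt : ∀ j ∈ O, j < nsK G nb := fun j hj => ((hOmem j).1 hj).1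
  have helt : ∀ j ∈ e, j < nsK G nb := fun j hj => hOlt j (List.mem_of_mem_filter hj)
  have heM : xorIdx M e = xorIdx fc e := xorIdx_congr fun j hj => hM j (helt j hj)
  have hfr : frhs Mp P = lin (fun j => col (G.partner (G.emb j))) (nsK G nb) 0 t := by
    rw [frhs, xorIdx_congr (h := fun j => col (G.partner (G.emb j))) (fun j hj => hMp j (hPlt j hj)),
      xorIdx_eq_lin _ _ _ hPlt, hPmask]
  -- mask of e = a ∧ b
  have hOnodup : O.Nodup := hOdef ▸ nodup_bitsOf _ _ _
  have hecard : e.length = popc (nsK G nb) (a &&& b) := by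
    rw [popc_eq_card, hedef, ← List.toFinset_card_of_nodup (hOnodup.filter _), List.toFinset_filter]
    congr 1
    ext i
    simp only [Finset.mem_filter, Finset.mem_range, List.mem_toFinset, hOmem]
    constructor
    · rintro ⟨⟨hi, -⟩, hb'⟩; exact ⟨hi, hb'⟩
    · rintro ⟨hi, hb'⟩
      refine ⟨⟨hi, ?_⟩, hb'⟩
      rw [hPdef, mem_bitsOf_zero_iff, ← hab, Nat.testBit_xor]
      rw [Nat.testBit_and, Bool.and_eq_true] at hb'
      rw [hb'.1, hb'.2]; simp
  have hemask : maskOf e = a &&& b := by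
    rw [hedef, maskOf_filter_testBit]
    apply Nat.eq_of_testBit_eq; intro i
    rw [Nat.testBit_and, testBit_maskOf_nodup O hOnodup]
    rcases hbit : (a &&& b).testBit i with _ | _
    · simp
    · simp only [Bool.true_and, decide_eq_true_eq, hOmem]
      rw [Nat.testBit_and, Bool.and_eq_true] at hbit
      refine ⟨?_, ?_⟩
      · by_contra hi
        rw [not_lt] at hi
        have := Nat.testBit_lt_two_pow (lt_of_lt_of_le (aPartK_lt hG u) (Nat.pow_le_pow_right (by norm_num) hi))
        rw [← ha] at this; rw [this] at hbit; exact Bool.false_ne_true hbit.1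
      · have hti : t.testBit i = false := by
          rw [← hab, Nat.testBit_xor, hbit.1, hbit.2]; rfl
        rw [hPdef, mem_bitsOf_zero_iff, hti]; simp
  -- budget
  have hw : popc (nK G nb) u = popc (nsK G nb) t + 2 * popc (nsK G nb) (a &&& b) := by
    rw [popc_eq_partsK hG hu, ← ha, ← hb, ← popc_xor_add, hab]
  have hlen : e.length ≤ (W - P.length) / 2 := by rw [hecard, hPlen]; omega
  -- the linear system
  have hsys : selXor (P.map M) x = frhs Mp P ^^^ xorIdx M e := by
    have h0 : lin col (nK G nb) 0 u = 0 := hker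
    rw [reconK hG hu, lin_xor, lin_col_embWK hG, lin_col_parWK hG, ← ha, ← hb, hbt, lin_xor] at h0
    have hf : lin (fun j => col (G.emb j)) (nsK G nb) 0 a ^^^ lin (fun j => col (G.partner (G.emb j))) (nsK G nb) 0 a =
        lin fc (nsK G nb) 0 a := by rw [← lin_xor_fun]
    have ha2 : lin fc (nsK G nb) 0 a = xorIdx M e ^^^ selXor (P.map M) x := by
      conv_lhs => rw [← and_xor_self_decomp a b, hab, lin_xor]
      rw [heM, hPM, xorIdx_eq_lin _ _ _ helt, hemask, selXor_map_eq_lin _ _ _ hPlt, hxdef, selP_restrictTo, hPmask]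
    rw [← Nat.xor_assoc, hf, ← hfr, ha2] at h0
    exact xor_eq_of_xor_xor_eq_zero h0
  -- the solver lists x, and the leaf is not pruned
  have hpiv := pivOKcore_of_fiberK G (nsK G nb) M Mp W P hout
  have hxlt : x < 2 ^ (P.map M).length := by
    rw [List.length_map, hxdef]; have := restrictTo_lt P 0 a; rwa [Nat.zero_add] at this
  have hxsol : x ∈ (gaussPiv (P.map M)).solutions (P.map M) (frhs Mp P ^^^ xorIdx M e) := by
    have := solutions_complete hpiv x
    rwa [Nat.mod_eq_of_lt hxlt, hsys] at this
  have hred : 1 ≤ (W - P.length) / 2 → (gaussPiv (P.map M)).red (frhs Mp P ^^^ xorIdx M e) = 0 := fun hs => by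
    rw [← hsys]; exact red_selXor (pivOK_of_fiberK G (nsK G nb) M Mp W P hout hs) x
  -- hence the word is produced
  have herev : ∀ j ∈ e.reverse, j < nsK G nb := fun j hj => helt j (List.mem_reverse.1 hj)
  refine ⟨mkWord G P e.reverse x, mem_fiberK_of_solution G (nsK G nb) M Mp W P hout e (List.filter_sublist) hlen hred x hxsol,
    ?_, mkWord_boundK hG P e.reverse hPlt herev x, ?_⟩
  · have h1 : (a &&& b) ^^^ (a &&& t) = a := by rw [← hab]; exact and_xor_self_decomp a b
    have h2 : (a &&& b) ^^^ (t ^^^ (a &&& t)) = b := by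
      rw [Nat.xor_left_comm, h1, hbt, Nat.xor_comm]
    rw [maskOf_mkWordK P e.reverse hPlt herev, maskOf_reverse, hemask, hxdef, selP_restrictTo, hPmask, h1, h2]
    exact (reconK hG hu).symm
  · rw [Geo.length_mkWord, List.length_reverse, hw, hecard, hPlen]; ring

end Complete

end Summit.Ventures.QEC.CircuitDistance.ETower
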